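import Mathlib
import Summits.KontsevichZagierPeriods.Zeta5Search.Families.BasicGrowthCritical
import Summits.KontsevichZagierPeriods.Zeta5Search.Families.CoeffAsympMain
import Summits.KontsevichZagierPeriods.Zeta5Search.Families.SpanProductHall
import HarnessLib

/-!
# ζ(5) search — Families: the gap constant terms of ANY seating grow exactly like `1/M_τ` (growth = reciprocal decay)

HONEST FRAMING: systematic search; no irrationality claim unless certified.  Cell `pub-zeta5`, certifier 2 (cert-2 g11,
2026-08-22).  Elementary real analysis of the coefficients of powers of a polynomial with non-negative integer
coefficients; nothing about the arithmetic of any zeta value; no conjecture node is used; no number of record moves.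

WHAT.  For a bijective seating `τ` of `n = ℓ + 3` points (P2's simplicial convention of `Families/CellularIntegral`:
label `ℓ + 2` is the point at infinity, the finite points `0 < 1 < ⋯ < ℓ+1` in increasing order, `ℓ + 1` consecutive
GAPS `g_w = pt (w+1) − pt w`), the `ℓ + 1` finite edges `{τ_i, τ_{i+1}}` of the polygon `τδ⁰` span the gap intervals
`[min, max)`.  Put
* `gapPoly τ n = ∏_{finite τ-edges e} (Σ_{w ∈ span e} X_w)^n ∈ ℤ[X_0,…,X_ℓ]` (a `SpanHall.spanProd`, `Families/SpanProductHall`),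
* **`gapCT τ n = [X^{n·𝟙}] gapPoly τ n`** — the diagonal GAP CONSTANT TERM of the seating (a non-negative integer: the
  number of transport tables; for the thirteen `N = 8` census frames these are fam-brown8's leading coefficients
  `Brown8.lead_<class>`, by the cubical-chart bookkeeping files `Families/CubicalChartLead*`).
THEOREM (`tendsto_log_gapCT_div`): if `gapCT τ 1 ≠ 0` then

  `log (gapCT τ n) / n ⟶ − log M_τ`,   `M_τ = fSup τ = sup_{simplex} f_τ` (P2's growth constant, `Families/BasicGrowth`),

i.e. the leading coefficients grow at EXACTLY the exponential rate at which the basic cellular integrals `I_τ(N)` decay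
(`Families/BasicGrowth.tendsto_integral_basic_root`).  PROOF: cert-2 g9's coefficient-asymptotics engine
(`CoeffAsymp.tendsto_log_coeff_pow_div`: `log [X^{n𝟙}] Pⁿ / n → log ⨅_u Σ_α [X^α]P e^{(α−𝟙)·u}`) and the observation that
the tilt `P(e^u)/e^{𝟙·u}` is `1 / gapF τ (e^u)` — the RECIPROCAL of Brown's function in P2's free gap coordinates
(`Families/BasicGrowthCritical.gapF`, `fSigma_eq_gapF`); so `⨅_u tilt = 1 / sup gapF = 1 / M_τ` (`gapF_le_fSup`,
`exists_lt_fSigma`).  No Möbius identity and no projective duality is needed (contrast `Families/CubicalChartVIMDual`).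
`tendsto_log_gapCT_div_of_mem_Icc` turns a certified enclosure `m ≤ M_τ ≤ M` (P2's `Families/Cellular*GrowthConstants*`)
into `lim ∈ [−log M, −log m]`.  Standard axioms only.
-/

noncomputable section

open Finset Real Filter Topology

namespace Summit.KontsevichZagierPeriods.Zeta5Search.Families.Cellular

namespace SeatingGap

variable {ℓ : ℕ} (τ : Fin (ℓ + 3) → Fin (ℓ + 3))

/-! ## The gap polynomial and the gap constant terms of a seating -/

/-- The gaps spanned by the edge at position `i` of `τδ⁰`: `min(τ_i, τ_{i+1}) ≤ w < max(τ_i, τ_{i+1})` (meaningful for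
finite edges; it is `(cellEdges τ _).span (Sum.inr ⟨i, _⟩)` of `Families/CellularEdges`). -/
def edgeSpan (i : Fin (ℓ + 3)) : Finset (Fin (ℓ + 1)) :=
  univ.filter fun w => min (τ i).val (τ (i + 1)).val ≤ w.val ∧ w.val < max (τ i).val (τ (i + 1)).val

/-- The exponent vector of the basic member: `n` on the finite edges, `0` on the two edges through `∞ = ℓ + 2`. -/
def finExp (n : ℕ) (i : Fin (ℓ + 3)) : ℕ := if (τ i).val ≠ ℓ + 2 ∧ (τ (i + 1)).val ≠ ℓ + 2 then n else 0

/-- **The gap polynomial** `∏_{finite edges e of τδ⁰} (Σ_{w ∈ span e} X_w)^n`. -/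
def gapPoly (n : ℕ) : MvPolynomial (Fin (ℓ + 1)) ℤ := SpanHall.spanProd (edgeSpan τ) (finExp τ n)

/-- The all-ones exponent vector. -/
def ones (m : ℕ) : Fin m →₀ ℕ := Finsupp.equivFunOnFinite.symm fun _ => 1

/-- **The diagonal gap constant term** `gapCT τ n = [X^{n·𝟙}] gapPoly τ n`. -/
def gapCT (n : ℕ) : ℤ := MvPolynomial.coeff (n • ones (ℓ + 1)) (gapPoly τ n)

/-- `finExp τ n = n · finExp τ 1`. -/
theorem finExp_eq_mul (n : ℕ) (i : Fin (ℓ + 3)) : finExp τ n i = finExp τ 1 i * n := by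
  unfold finExp; split_ifs <;> simp

/-- `gapPoly τ n = (gapPoly τ 1)^n`. -/
theorem gapPoly_eq_pow (n : ℕ) : gapPoly τ n = gapPoly τ 1 ^ n := by
  unfold gapPoly SpanHall.spanProd
  rw [← Finset.prod_pow]
  refine Finset.prod_congr rfl fun i _ => ?_
  rw [← pow_mul, finExp_eq_mul]

/-- The coefficients of the gap polynomial are non-negative. -/
theorem coeff_gapPoly_nonneg (n : ℕ) (m : Fin (ℓ + 1) →₀ ℕ) : 0 ≤ MvPolynomial.coeff m (gapPoly τ n) :=
  SpanHall.coeff_spanProd_nonneg _ _ _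

/-- `gapCT τ n ≥ 0`. -/
theorem gapCT_nonneg (n : ℕ) : 0 ≤ gapCT τ n := coeff_gapPoly_nonneg τ n _

/-- The gap polynomial is homogeneous of degree `Σ_i finExp τ n i` (`= (ℓ+1)·n` for a bijective seating). -/
theorem gapPoly_isHomogeneous (n : ℕ) : (gapPoly τ n).IsHomogeneous (∑ i, finExp τ n i) := by
  unfold gapPoly SpanHall.spanProd
  refine MvPolynomial.IsHomogeneous.prod _ _ _ fun i _ => ?_
  have h1 : (SpanHall.spanPoly (edgeSpan τ) i).IsHomogeneous 1 :=
    MvPolynomial.IsHomogeneous.sum _ _ _ fun w _ => MvPolynomial.isHomogeneous_X ℤ w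
  simpa using h1.pow (finExp τ n i)

/-- `n • 𝟙` is the constant exponent vector `n`. -/
theorem smul_ones (m n : ℕ) : n • ones m = Finsupp.equivFunOnFinite.symm fun _ => n := by
  ext i; simp [ones]

/-! ## Real coefficients and the evaluation at a gap vector -/

/-- The gap polynomial `P = gapPoly τ 1` with real coefficients. -/
def gapPolyR : MvPolynomial (Fin (ℓ + 1)) ℝ := MvPolynomial.map (Int.castRingHom ℝ) (gapPoly τ 1)

/-- `gapCT τ n = [X^{n𝟙}] Pⁿ` (real coefficients). -/
theorem gapCT_eq_coeff_pow (n : ℕ) :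
    (gapCT τ n : ℝ) = MvPolynomial.coeff (n • ones (ℓ + 1)) (gapPolyR τ ^ n) := by
  rw [gapCT, gapPoly_eq_pow, gapPolyR, ← map_pow, MvPolynomial.coeff_map]
  simp

/-- `P` has non-negative coefficients. -/
theorem coeff_gapPolyR_nonneg (m : Fin (ℓ + 1) →₀ ℕ) : 0 ≤ MvPolynomial.coeff m (gapPolyR τ) := by
  rw [gapPolyR, MvPolynomial.coeff_map, eq_intCast]
  exact_mod_cast coeff_gapPoly_nonneg τ 1 m

/-- `[X^𝟙] P = gapCT τ 1`. -/
theorem coeff_ones_gapPolyR : MvPolynomial.coeff (ones (ℓ + 1)) (gapPolyR τ) = gapCT τ 1 := by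
  have h := gapCT_eq_coeff_pow τ 1
  rw [pow_one, one_smul] at h
  exact h.symm

/-- **Evaluation**: `P(g) = ∏_i [finite i] (Σ_{w ∈ span i} g_w)` (the two infinite edges contribute `1`). -/
theorem eval_gapPolyR (g : Fin (ℓ + 1) → ℝ) : MvPolynomial.eval g (gapPolyR τ) =
    ∏ i : Fin (ℓ + 3), if (τ i).val ≠ ℓ + 2 ∧ (τ (i + 1)).val ≠ ℓ + 2 then ∑ w ∈ edgeSpan τ i, g w else 1 := by
  rw [gapPolyR, gapPoly, SpanHall.spanProd, map_prod, map_prod]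
  refine Finset.prod_congr rfl fun i _ => ?_
  rw [map_pow, map_pow, SpanHall.spanPoly, map_sum, map_sum]
  simp only [MvPolynomial.map_X, MvPolynomial.eval_X, finExp]
  split_ifs <;> simp

/-- The span of a finite edge is the span of `Families/CellularEdges.cellEdges`. -/
theorem edgeSpan_eq_span (hτi : Function.Injective τ) (e : SEdge τ) :
    edgeSpan τ e.1 = (cellEdges τ hτi).span (Sum.inr e) := by
  ext w
  simp [edgeSpan, EdgeFamily.mem_span, cellEdges]

/-- **`P(g)/g^𝟙 = 1 / gapF τ g`**: the tilt of the gap polynomial is the reciprocal of Brown's function in free gap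
coordinates (`Families/BasicGrowthCritical.gapF`). -/
theorem eval_div_prod_eq_inv_gapF (hτi : Function.Injective τ) (g : Fin (ℓ + 1) → ℝ) :
    MvPolynomial.eval g (gapPolyR τ) / ∏ w, g w = (gapF τ hτi g)⁻¹ := by
  rw [gapF, inv_div, eval_gapPolyR]
  congr 1
  rw [← Finset.prod_filter, Finset.prod_subtype (univ.filter fun i : Fin (ℓ + 3) =>
    (τ i).val ≠ ℓ + 2 ∧ (τ (i + 1)).val ≠ ℓ + 2) (p := fun i : Fin (ℓ + 3) => (τ i).val ≠ ℓ + 2 ∧ (τ (i + 1)).val ≠ ℓ + 2)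
    (fun i => by simp)]
  exact Finset.prod_congr rfl fun e _ => by rw [edgeSpan_eq_span τ hτi e]

/-! ## The tilt dictionary and the infimum -/

/-- **Tilt dictionary**: `Σ_α [X^α]P · e^{(α − 𝟙)·u} = P(e^u) / ∏_w e^{u_w}`. -/
theorem tilt_eq (u : Fin (ℓ + 1) → ℝ) :
    CoeffAsymp.tilt (gapPolyR τ).support (fun m => MvPolynomial.coeff m (gapPolyR τ)) (ones (ℓ + 1)) u =
      MvPolynomial.eval (fun i => exp (u i)) (gapPolyR τ) / ∏ i, exp (u i) := by
  have hdot : ∀ α : Fin (ℓ + 1) →₀ ℕ, exp (CoeffAsymp.dot (ones (ℓ + 1)) α u) =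
      (∏ i, exp (u i) ^ (α i)) / ∏ i, exp (u i) := by
    intro α
    have hs : CoeffAsymp.dot (ones (ℓ + 1)) α u = (∑ i, (α i : ℝ) * u i) - ∑ i, u i := by
      simp only [CoeffAsymp.dot, CoeffAsymp.dvec, ones, Finsupp.coe_equivFunOnFinite_symm, Nat.cast_one, sub_mul,
        one_mul, Finset.sum_sub_distrib]
    rw [hs, Real.exp_sub, Real.exp_sum, Real.exp_sum]
    congr 1
    refine Finset.prod_congr rfl fun i _ => ?_
    rw [← Real.exp_nat_mul]
  unfold CoeffAsymp.tilt
  simp_rw [hdot, mul_div_assoc']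
  rw [← Finset.sum_div, ← MvPolynomial.eval_eq']

/-- The tilt at `u` is `1 / gapF τ (e^u)`. -/
theorem tilt_eq_inv_gapF (hτi : Function.Injective τ) (u : Fin (ℓ + 1) → ℝ) :
    CoeffAsymp.tilt (gapPolyR τ).support (fun m => MvPolynomial.coeff m (gapPolyR τ)) (ones (ℓ + 1)) u =
      (gapF τ hτi fun i => exp (u i))⁻¹ := by
  rw [tilt_eq, eval_div_prod_eq_inv_gapF τ hτi]

/-- The tilt is bounded below (by `0`). -/
theorem bddBelow_tilt : BddBelow (Set.range fun u : Fin (ℓ + 1) → ℝ =>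
    CoeffAsymp.tilt (gapPolyR τ).support (fun m => MvPolynomial.coeff m (gapPolyR τ)) (ones (ℓ + 1)) u) := by
  refine ⟨0, ?_⟩
  rintro _ ⟨u, rfl⟩
  exact Finset.sum_nonneg fun α _ => mul_nonneg (coeff_gapPolyR_nonneg τ α) (Real.exp_pos _).le

/-- **`⨅_u tilt(u) = 1 / M_τ`** (for `gapCT τ 1 ≠ 0`, which makes the infimum positive). -/
theorem iInf_tilt_eq_inv_fSup (hτ : Function.Bijective τ) (h1 : gapCT τ 1 ≠ 0) :
    (⨅ u : Fin (ℓ + 1) → ℝ,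
      CoeffAsymp.tilt (gapPolyR τ).support (fun m => MvPolynomial.coeff m (gapPolyR τ)) (ones (ℓ + 1)) u) =
      (fSup τ)⁻¹ := by
  set T : (Fin (ℓ + 1) → ℝ) → ℝ := fun u =>
    CoeffAsymp.tilt (gapPolyR τ).support (fun m => MvPolynomial.coeff m (gapPolyR τ)) (ones (ℓ + 1)) u with hT
  have hMpos : 0 < fSup τ := fSup_pos τ hτ
  apply le_antisymm
  · -- `⨅ T ≤ 1/M`: otherwise `c = 1/⨅T < M`, a point of the simplex has `f_τ > c`, and its gaps tilt below `⨅ T`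
    have hc : ∀ m ∈ (gapPolyR τ).support, 0 < MvPolynomial.coeff m (gapPolyR τ) := fun m hm =>
      lt_of_le_of_ne (coeff_gapPolyR_nonneg τ m) (Ne.symm (MvPolynomial.mem_support_iff.1 hm))
    have hB : ones (ℓ + 1) ∈ (gapPolyR τ).support :=
      MvPolynomial.mem_support_iff.2 (by rw [coeff_ones_gapPolyR]; exact_mod_cast h1)
    have hIpos : 0 < ⨅ u, T u := CoeffAsymp.iInf_tilt_pos hc hB
    by_contra hlt
    push Not at hlt
    have hcM : (⨅ u, T u)⁻¹ < fSup τ := by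
      have := inv_strictAnti₀ (inv_pos.2 hMpos) hlt
      rwa [inv_inv] at this
    obtain ⟨t, ht, hct⟩ := exists_lt_fSigma τ hcM
    have hg : ∀ w : Fin (ℓ + 1), 0 < gapN t w := (mem_openSimplex_iff_gapN t).1 ht
    set u : Fin (ℓ + 1) → ℝ := fun w => Real.log (gapN t w) with hu
    have hTu : T u = (fSigma τ t)⁻¹ := by
      simp only [hT]
      rw [tilt_eq_inv_gapF τ hτ.1, fSigma_eq_gapF τ hτ ht]
      congr 2
      funext w
      exact Real.exp_log (hg w)
    have h1 : ⨅ u, T u ≤ T u := ciInf_le (bddBelow_tilt τ) u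
    have h2 : T u < ⨅ u, T u := by
      rw [hTu]
      have := inv_strictAnti₀ (inv_pos.2 hIpos) hct
      rwa [inv_inv] at this
    exact absurd (lt_of_le_of_lt h1 h2) (lt_irrefl _)
  · -- `1/M ≤ T u` for every `u`: `gapF ≤ M` on the positive orthant
    refine le_ciInf fun u => ?_
    simp only [hT]
    rw [tilt_eq_inv_gapF τ hτ.1]
    exact inv_anti₀ (gapF_pos τ hτ.1 fun w => Real.exp_pos _) (gapF_le_fSup τ hτ fun w => Real.exp_pos _)

/-! ## The theorem -/

/-- **Growth = reciprocal decay.**  For a bijective seating `τ` with `gapCT τ 1 ≠ 0`: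
`log (gapCT τ n) / n → −log M_τ`, `M_τ = fSup τ` the growth constant of the basic cellular integrals of `τ`. -/
theorem tendsto_log_gapCT_div (hτ : Function.Bijective τ) (h1 : gapCT τ 1 ≠ 0) :
    Tendsto (fun n : ℕ => Real.log (gapCT τ n : ℝ) / n) atTop (𝓝 (-Real.log (fSup τ))) := by
  have h := CoeffAsymp.tendsto_log_coeff_pow_div (gapPolyR τ) (coeff_gapPolyR_nonneg τ) (B := ones (ℓ + 1))
    (by rw [coeff_ones_gapPolyR]; exact_mod_cast h1)
  rw [iInf_tilt_eq_inv_fSup τ hτ h1, Real.log_inv] at h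
  refine Tendsto.congr (fun n => ?_) h
  rw [gapCT_eq_coeff_pow]

/-- **With a certified enclosure** `m ≤ M_τ ≤ M` (`0 < m`): the growth exponent `L = lim log (gapCT τ n)/n` exists and
`−log M ≤ L ≤ −log m`, i.e. the growth factor `e^L = 1/M_τ` lies in `[1/M, 1/m]`. -/
theorem tendsto_log_gapCT_div_of_mem_Icc (hτ : Function.Bijective τ) (h1 : gapCT τ 1 ≠ 0) {m M : ℝ} (hm : 0 < m)
    (hmem : fSup τ ∈ Set.Icc m M) :
    ∃ L : ℝ, Tendsto (fun n : ℕ => Real.log (gapCT τ n : ℝ) / n) atTop (𝓝 L) ∧ Real.exp L = (fSup τ)⁻¹ ∧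
      -Real.log M ≤ L ∧ L ≤ -Real.log m := by
  refine ⟨-Real.log (fSup τ), tendsto_log_gapCT_div τ hτ h1, ?_, ?_, ?_⟩
  · rw [Real.exp_neg, Real.exp_log (fSup_pos τ hτ)]
  · exact neg_le_neg (Real.log_le_log (fSup_pos τ hτ) hmem.2)
  · exact neg_le_neg (Real.log_le_log hm hmem.1)

end SeatingGap

end Summit.KontsevichZagierPeriods.Zeta5Search.Families.Cellular
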